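import Literature.Algebra.Lie.PoincareBirkhoffWitt
import Mathlib.Algebra.MvPolynomial.Derivation
import Mathlib.RingTheory.MvPolynomial.Homogeneous
import Mathlib.Tactic.NoncommRing
import HarnessLib

/-!
# Symbols: the associated graded algebra of `U(L)` is the symmetric algebra `S(L)`

Continuation of `Literature/Algebra/Lie/PoincareBirkhoffWitt.lean`. For a Lie algebra `L` over a
commutative ring `R` with a basis `b` indexed by a linearly ordered type `σ`, the PBW theorem
identifies `U(L)` with `S(L) = R[z_i : i ∈ σ]` as filtered `R`-modules (`symbAll`, the *total
symbol*: `x_s ↦ z_s` in PBW coordinates). This file develops the **symbol calculus**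
`σ_k : U_k → S^k(L)` (Humphreys 1972, §17.3 Theorem: `gr U(L) ≅ S(L)`; Bourbaki LIE I §2.7):

* `symb b k` — the `k`-th symbol (degree-`k` part of the total symbol), `symb_word`: the symbol of
  any word of length `k` is the corresponding monomial (straightening);
* `symb_mul` — multiplicativity `σ_{j+k}(uv) = σ_j(u) σ_k(v)` (`gr U(L)` is commutative and the
  symbol is an algebra map);
* `adU_mem_fil_and_symb_adU` — equivariance: `ad(ι x)` preserves `U_k` and
  `σ_k(ι(x)u - uι(x)) = ad_S(x)(σ_k u)`, where `adS b x` is the derivation of `S(L)` extending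
  `ad x` on generators; hence the top symbol of a central element is an `L`-invariant of `S(L)`
  (`adS_symb_eq_zero_of_commute`), the input of Bourbaki's proof of the Harish-Chandra
  isomorphism (LIE VIII §8.5 Th. 2, step (b));
* `exists_symb_ne_zero` — a nonzero element has a nonzero top symbol;
* `symbAll`, `coeff_symbAll`, `homogeneousComponent_symbAll`, `totalDegree_symbAll_le`.

## References

* J. E. Humphreys, *Introduction to Lie Algebras and Representation Theory*, Springer 1972,
  §17.3 (Theorem, Corollary C), §23.3.
* N. Bourbaki, *Lie Groups and Lie Algebras*, Ch. I §2.7; Ch. VIII §8.5.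
-/

noncomputable section

open MvPolynomial Finsupp UniversalEnvelopingAlgebra

-- Mathlib idiom (Mathlib/Algebra/Lie/OfAssociative.lean, UniversalEnveloping.lean): commutator brackets
attribute [local instance 100] LieRing.ofAssociativeRing

namespace Literature.Algebra.Lie.PBW

variable {σ : Type*} {R : Type*} [CommRing R] [LinearOrder σ] {L : Type*} [LieRing L]
  [LieAlgebra R L] (b : Module.Basis σ R L)

local notation "S" => MvPolynomial σ R
local notation "U" => UniversalEnvelopingAlgebra R L

/-! ### The symbol maps -/

/-- The **`k`-th symbol map** `σ_k : U(L) → S^k(L) ⊆ S(L) = R[z_i]`: in PBW coordinates, keep the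
ordered monomials of degree exactly `k` and replace `x_s` by `z_s`. On `U_k = fil k` this is the
canonical map `U_k → U_k/U_{k-1} ≅ S^k(L)` (Humphreys §17.3 Theorem: `gr U(L) ≅ S(L)`;
Bourbaki LIE I §2.7). [cite: Humphreys1972, §17.3 Theorem and Corollary C] -/
def symb (k : ℕ) : U →ₗ[R] S :=
  (pbwBasis b).constr R fun s ↦ if s.degree = k then monomial s 1 else 0

/-- The symbol of an ordered monomial. [cite: Humphreys1972, §17.3] -/
theorem symb_ordMonomial (k : ℕ) (s : σ →₀ ℕ) :
    symb b k (ordMonomial b s) = if s.degree = k then monomial s 1 else 0 := by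
  rw [← pbwBasis_apply, symb, Module.Basis.constr_basis]

/-- Coefficients of the symbol are PBW coordinates. [cite: Humphreys1972, §17.3 Corollary C] -/
theorem coeff_symb (k : ℕ) (u : U) (s : σ →₀ ℕ) :
    coeff s (symb b k u) = if s.degree = k then (pbwBasis b).repr u s else 0 := by
  classical
  rw [symb, Module.Basis.constr_apply, Finsupp.sum, coeff_sum]
  simp_rw [smul_ite, smul_zero]
  rw [Finset.sum_eq_single s]
  · by_cases h : s.degree = k
    · rw [if_pos h, if_pos h, coeff_smul, coeff_monomial, if_pos rfl, smul_eq_mul, mul_one]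
    · rw [if_neg h, if_neg h, coeff_zero]
  · intro t _ hts
    by_cases h : t.degree = k
    · rw [if_pos h, coeff_smul, coeff_monomial, if_neg hts, smul_zero]
    · rw [if_neg h, coeff_zero]
  · intro hs
    rw [Finsupp.notMem_support_iff.mp hs, zero_smul, ite_self, coeff_zero]

/-- `σ_k` kills `U_j` for `j < k`. [cite: Humphreys1972, §17.3] -/
theorem symb_eq_zero_of_mem_fil {j k : ℕ} (hjk : j < k) {u : U} (hu : u ∈ fil b j) : symb b k u = 0 := by
  ext s
  rw [coeff_symb, coeff_zero]
  split_ifs with h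
  · by_contra hne
    exact absurd ((mem_fil_iff_repr b).mp hu s hne) (by omega)
  · rfl

/-- **The symbol of a word** of length `k` is the corresponding monomial (straightening).
[cite: Humphreys1972, §17.3 Lemma and Theorem] -/
theorem symb_word {k : ℕ} {l : List σ} (hl : l.length = k) :
    symb b k (word b l) = monomial (Multiset.toFinsupp (l : Multiset σ)) 1 := by
  have hdeg : (Multiset.toFinsupp (l : Multiset σ)).degree = k := by rw [degree_toFinsupp_coe, hl]
  rcases Nat.eq_zero_or_pos k with rfl | hk
  · obtain rfl : l = [] := List.eq_nil_of_length_eq_zero hl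
    rw [word_nil, ← ordMonomial_zero b, symb_ordMonomial, Multiset.coe_nil, Multiset.toFinsupp_zero,
      if_pos (by simp)]
  · obtain ⟨k, rfl⟩ := Nat.exists_eq_add_one_of_ne_zero hk.ne'
    have h := word_sub_ordMonomial_mem b (l := l) (k := k) hl.le
    rw [← sub_add_cancel (word b l) (ordMonomial b _), map_add,
      symb_eq_zero_of_mem_fil b (Nat.lt_succ_self k) h, zero_add, symb_ordMonomial, if_pos hdeg]

/-- Every nonzero element of `U(L)` has a nonzero top symbol. [cite: Humphreys1972, §17.3 Corollary C] -/
theorem exists_symb_ne_zero {u : U} (hu : u ≠ 0) : ∃ k, u ∈ fil b k ∧ symb b k u ≠ 0 := by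
  classical
  have hne : ((pbwBasis b).repr u).support.Nonempty := by
    rw [Finset.nonempty_iff_ne_empty, Ne, Finsupp.support_eq_empty]
    exact fun h ↦ hu ((pbwBasis b).repr.map_eq_zero_iff.mp h)
  set k := ((pbwBasis b).repr u).support.sup Finsupp.degree with hk
  refine ⟨k, (mem_fil_iff_repr b).mpr fun s hs ↦ Finset.le_sup (Finsupp.mem_support_iff.mpr hs), ?_⟩
  obtain ⟨s, hs, hsk⟩ := Finset.exists_mem_eq_sup _ hne Finsupp.degree
  intro h0
  have := congrArg (coeff s) h0
  rw [coeff_symb, coeff_zero, if_pos (hk.trans hsk).symm] at this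
  exact (Finsupp.mem_support_iff.mp hs) this

/-! ### Multiplicativity of symbols -/

/-- `σ_{j+k}(u v) = σ_j(u) σ_k(v)` for `u = ` a sorted word of length `≤ j` and `v ∈ U_k`.
[cite: Humphreys1972, §17.3 Theorem] -/
theorem symb_word_mul {j k : ℕ} {l : List σ} (hl : l.length ≤ j) {v : U} (hv : v ∈ fil b k) :
    symb b (j + k) (word b l * v) = symb b j (word b l) * symb b k v := by
  rw [fil_eq_span_word] at hv
  refine Submodule.span_induction ?_ ?_ (fun x y _ _ hx hy ↦ ?_) (fun a x _ hx ↦ ?_) hv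
  · rintro _ ⟨l', hl', rfl⟩
    rcases hl.lt_or_eq with hj | hj
    · rw [symb_eq_zero_of_mem_fil b hj (word_mem_fil_of_length_le b le_rfl), zero_mul,
        symb_eq_zero_of_mem_fil b (j := l.length + k) (by omega)]
      rw [← word_append]
      exact word_mem_fil_of_length_le b (by rw [List.length_append]; omega)
    rcases hl'.lt_or_eq with hk' | hk'
    · rw [symb_eq_zero_of_mem_fil b hk' (word_mem_fil_of_length_le b le_rfl), mul_zero,
        symb_eq_zero_of_mem_fil b (j := j + l'.length) (by omega)]
      rw [← word_append]
      exact word_mem_fil_of_length_le b (by rw [List.length_append]; omega)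
    rw [← word_append, symb_word b (by rw [List.length_append, hj, hk']), symb_word b hj, symb_word b hk',
      monomial_mul, one_mul, ← Multiset.toFinsupp_add, Multiset.coe_add]
  · simp
  · rw [mul_add, map_add, map_add, hx, hy, mul_add]
  · rw [mul_smul_comm, map_smul, map_smul, hx, mul_smul_comm]

/-- **Symbols are multiplicative**: `σ_{j+k}(u v) = σ_j(u) σ_k(v)` for `u ∈ U_j`, `v ∈ U_k`
(`gr U(L)` is a commutative algebra and `σ` is an algebra map onto `S(L)`).
[cite: Humphreys1972, §17.3 Theorem] -/
theorem symb_mul {j k : ℕ} {u v : U} (hu : u ∈ fil b j) (hv : v ∈ fil b k) :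
    symb b (j + k) (u * v) = symb b j u * symb b k v := by
  rw [fil_eq_span_word] at hu
  refine Submodule.span_induction ?_ ?_ (fun x y _ _ hx hy ↦ ?_) (fun a x _ hx ↦ ?_) hu
  · rintro _ ⟨l, hl, rfl⟩
    exact symb_word_mul b hl hv
  · simp
  · rw [add_mul, map_add, map_add, hx, hy, add_mul]
  · rw [smul_mul_assoc, map_smul, map_smul, hx, smul_mul_assoc]

/-! ### Equivariance of symbols under the adjoint action -/

/-- The inner derivation `ad(ι x) : u ↦ ι(x) u - u ι(x)` of `U(L)`. [folklore] -/
def adU (x : L) : U →ₗ[R] U :=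
  LinearMap.mulLeft R (ι R x) - LinearMap.mulRight R (ι R x)

/-- Unfolding `adU`. [folklore] -/
theorem adU_apply (x : L) (u : U) : adU (R := R) x u = ι R x * u - u * ι R x := rfl

/-- The derivation of `S(L) = R[z_i]` induced by `ad x` on generators:
`z_i ↦ ∑_m ([x, x_i])_m z_m` (the adjoint = coadjoint action of `L` on `S(L)`). [folklore] -/
def adS (x : L) : Derivation R S S :=
  mkDerivation R fun i ↦ Finsupp.linearCombination R X (b.repr ⁅x, b i⁆)

omit [LinearOrder σ] in
/-- The derivation `adS x` on a variable. [folklore] -/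
theorem adS_X (x : L) (i : σ) : adS b x (X i) = Finsupp.linearCombination R X (b.repr ⁅x, b i⁆) :=
  mkDerivation_X _ _ _

/-- The word with a general element in front: `ι(y) · x_l` has symbol `(coordinates of y) · z_l`.
[folklore] -/
theorem symb_ι_mul_word (y : L) (l : List σ) :
    symb b (l.length + 1) (ι R y * word b l) =
      Finsupp.linearCombination R X (b.repr y) * monomial (Multiset.toFinsupp (l : Multiset σ)) 1 := by
  conv_lhs => rw [← b.linearCombination_repr y]
  rw [Finsupp.linearCombination_apply, Finsupp.linearCombination_apply, map_finsuppSum,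
    Finsupp.sum_mul, map_finsuppSum, Finsupp.sum_mul]
  refine Finset.sum_congr rfl fun m _ ↦ ?_
  dsimp only
  rw [map_smul, smul_mul_assoc, map_smul, ← word_cons,
    symb_word b (k := l.length + 1) (l := m :: l) rfl, smul_mul_assoc, ← Multiset.cons_coe,
    ← Multiset.singleton_add, Multiset.toFinsupp_add, Multiset.toFinsupp_singleton, X_mul_monomial]

/-- **Equivariance of the symbol on words**: `ad(ι x)` preserves `U_k` and
`σ_k(ad(ι x) w) = ad_S(x)(σ_k w)` for a word `w` of length `k`. [cite: Humphreys1972, §17.3 (gr U(L) ≅ S(L) as L-modules); §23.3] -/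
theorem adU_word (x : L) (l : List σ) :
    adU (R := R) x (word b l) ∈ fil b l.length ∧
      symb b l.length (adU (R := R) x (word b l)) = adS b x (symb b l.length (word b l)) := by
  induction l with
  | nil =>
    have h1 : adU (R := R) x (word b []) = 0 := by
      rw [word_nil, adU_apply, mul_one, one_mul, sub_self]
    refine ⟨by rw [h1]; exact zero_mem _, ?_⟩
    rw [h1, map_zero, symb_word b rfl, Multiset.coe_nil, Multiset.toFinsupp_zero]
    exact (adS b x).map_one_eq_zero.symm
  | cons i l ih =>
    obtain ⟨ih1, ih2⟩ := ih
    have key : adU (R := R) x (word b (i :: l)) =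
        ι R ⁅x, b i⁆ * word b l + ι R (b i) * adU (R := R) x (word b l) := by
      rw [adU_apply, adU_apply, word_cons, LieHom.map_lie, LieRing.of_associative_ring_bracket]
      noncomm_ring
    constructor
    · rw [key, List.length_cons]
      exact add_mem (ι_mul_mem_fil b _ (word_mem_fil_of_length_le b le_rfl)) (ι_mul_mem_fil b _ ih1)
    · have e : symb b (l.length + 1) (ι R (b i) * adU (R := R) x (word b l)) =
          X i * adS b x (symb b l.length (word b l)) := by
        rw [add_comm, symb_mul b (ι_mem_fil_one b (b i)) ih1, ih2, ← word_singleton b,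
          symb_word b (k := 1) (l := [i]) rfl, Multiset.coe_singleton, Multiset.toFinsupp_singleton]
        rfl
      rw [key, map_add, List.length_cons, symb_ι_mul_word, e,
        symb_word b (k := l.length + 1) (l := i :: l) rfl, ← Multiset.cons_coe, ← Multiset.singleton_add,
        Multiset.toFinsupp_add, Multiset.toFinsupp_singleton, ← X_mul_monomial, Derivation.leibniz,
        smul_eq_mul, smul_eq_mul, adS_X, symb_word b rfl]
      ring

/-- **Equivariance of the symbol**: for `u ∈ U_k`, `ad(ι x) u ∈ U_k` and
`σ_k(ι(x) u - u ι(x)) = ad_S(x) (σ_k u)`. In particular the top symbol of a central element of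
`U(L)` is an `L`-invariant of `S(L)`. [cite: Humphreys1972, §17.3 and §23.3] -/
theorem adU_mem_fil_and_symb_adU (x : L) {k : ℕ} {u : U} (hu : u ∈ fil b k) :
    adU (R := R) x u ∈ fil b k ∧ symb b k (adU (R := R) x u) = adS b x (symb b k u) := by
  rw [fil_eq_span_word] at hu
  refine Submodule.span_induction ?_ ?_ (fun y z _ _ hy hz ↦ ?_) (fun a y _ hy ↦ ?_) hu
  · rintro _ ⟨l, hl, rfl⟩
    obtain ⟨h1, h2⟩ := adU_word b x l
    rcases hl.lt_or_eq with hlt | rfl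
    · refine ⟨fil_mono b hl h1, ?_⟩
      rw [symb_eq_zero_of_mem_fil b hlt h1, symb_eq_zero_of_mem_fil b hlt (word_mem_fil_of_length_le b le_rfl),
        map_zero]
    · exact ⟨h1, h2⟩
  · simp
  · refine ⟨?_, ?_⟩
    · rw [map_add]
      exact add_mem hy.1 hz.1
    · rw [map_add, map_add, hy.2, hz.2, map_add, map_add]
  · refine ⟨?_, ?_⟩
    · rw [map_smul]
      exact Submodule.smul_mem _ a hy.1
    · rw [map_smul, map_smul, hy.2, map_smul, Derivation.map_smul]

/-- The top symbol of a central element is `ad`-invariant: if `u ∈ U_k` commutes with `ι(x)` then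
`ad_S(x) (σ_k u) = 0`. [cite: Humphreys1972, §23.3; Bourbaki LIE VIII §8.5 proof of Th. 2 (b)] -/
theorem adS_symb_eq_zero_of_commute (x : L) {k : ℕ} {u : U} (hu : u ∈ fil b k)
    (hcomm : ι R x * u = u * ι R x) : adS b x (symb b k u) = 0 := by
  rw [← (adU_mem_fil_and_symb_adU b x hu).2, adU_apply, hcomm, sub_self, map_zero]

/-- `ad(ι x)` is a derivation: `ad(ι x)(ι(y) u) = ι([x,y]) u + ι(y) ad(ι x)(u)`. [folklore] -/
theorem adU_ι_mul (x y : L) (u : U) :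
    adU (R := R) x (ι R y * u) = ι R ⁅x, y⁆ * u + ι R y * adU (R := R) x u := by
  rw [adU_apply, adU_apply, LieHom.map_lie, LieRing.of_associative_ring_bracket]
  noncomm_ring

/-! ### The total symbol (PBW symmetrisation inverse) -/

/-- The **total symbol** `U(L) → S(L)`, `x_s ↦ z_s` in PBW coordinates: the `R`-linear
isomorphism of the PBW theorem (inverse to the "symmetrisation by ordered monomials"), whose
degree-`k` homogeneous component is `σ_k`. [cite: Humphreys1972, §17.3 Corollary C] -/
def symbAll : U →ₗ[R] S :=
  (pbwBasis b).constr R fun s ↦ monomial s 1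

/-- The total symbol of an ordered monomial. [cite: Humphreys1972, §17.3 Corollary C] -/
theorem symbAll_ordMonomial (s : σ →₀ ℕ) : symbAll b (ordMonomial b s) = monomial s 1 := by
  rw [← pbwBasis_apply, symbAll, Module.Basis.constr_basis]

/-- Coefficients of the total symbol are the PBW coordinates. [cite: Humphreys1972, §17.3 Corollary C] -/
theorem coeff_symbAll (u : U) (s : σ →₀ ℕ) : coeff s (symbAll b u) = (pbwBasis b).repr u s := by
  classical
  rw [symbAll, Module.Basis.constr_apply, Finsupp.sum, coeff_sum]
  simp_rw [coeff_smul, coeff_monomial, smul_eq_mul, mul_ite, mul_one, mul_zero]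
  rw [Finset.sum_ite_eq']
  split_ifs with h
  · rfl
  · exact (Finsupp.notMem_support_iff.mp h).symm

/-- The total symbol is injective (PBW). [cite: Humphreys1972, §17.3 Corollary C] -/
theorem symbAll_injective : Function.Injective (symbAll b) := by
  intro u v huv
  apply (pbwBasis b).repr.injective
  ext s
  rw [← coeff_symbAll, ← coeff_symbAll, huv]

/-- The degree-`k` component of the total symbol is the `k`-th symbol. [cite: Humphreys1972, §17.3] -/
theorem homogeneousComponent_symbAll (k : ℕ) (u : U) :
    homogeneousComponent k (symbAll b u) = symb b k u := by
  classical
  ext s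
  rw [coeff_homogeneousComponent, coeff_symbAll, coeff_symb]

/-- The `k`-th symbol is homogeneous of degree `k`. [cite: Humphreys1972, §17.3] -/
theorem symb_isHomogeneous (k : ℕ) (u : U) : (symb b k u).IsHomogeneous k := by
  rw [← homogeneousComponent_symbAll]
  exact homogeneousComponent_isHomogeneous k _

/-- On `U_k` the total symbol has total degree `≤ k`. [cite: Humphreys1972, §17.3] -/
theorem totalDegree_symbAll_le {k : ℕ} {u : U} (hu : u ∈ fil b k) : (symbAll b u).totalDegree ≤ k := by
  rw [totalDegree, Finset.sup_le_iff]
  intro s hs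
  rw [MvPolynomial.mem_support_iff, coeff_symbAll] at hs
  exact (mem_fil_iff_repr b).mp hu s hs

end Literature.Algebra.Lie.PBW
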